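import Mathlib
import HarnessLib
import Literature.Analysis.FluidPDE.OseenMildPressureIdentification
import Literature.Analysis.FluidPDE.TsaiLocalPressureSup
import Summits.NavierStokesRegularity.NavierStokesRegularity.Theorems.PoloidalWindowDoorPoloidalWindowRigiditySparseEnergyScaledEnergyOfSplit
import Summits.NavierStokesRegularity.NavierStokesRegularity.Theorems.PoloidalWindowDoorPoloidalWindowRigiditySparseEnergyPressureSplitNear
import Summits.NavierStokesRegularity.NavierStokesRegularity.Theorems.PoloidalWindowDoorPoloidalWindowRigiditySparseEnergyPressureSplitFar

/-!
# Route `PoloidalWindowDoor`, crux `PoloidalWindowRigidity` (stmt-19708), line `sparse_energy` (cstrat g11) —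
# stub S1, FILE C (discharge of the window pressure split), piece C6: THE WINDOW PRESSURE SPLIT OF THE TYPE-I CLASS

Seat ns-poloidal-K2-p2 g10 (LEAD-lineage on 19708; file `--supports`).  For a profile `v` of the route's Type-I ancient mild class
(`HasTypeITimeDecay C v`, continuity, Oseen mildness between any two negative times, divergence-free slices) and every window
`(T, 0)`, `T < 0`, the classical pressure `q` of the window (`IsTypeIAncientMild.exists_isClassicalNSSolutionOn_Ioo`) SPLITS on every
ball `B̄(a,2R)` at every time `t ∈ (T,0)` as `q(t) = c + p₁ + p₂` with

* `p₁ = Q[ϑ•v(t)]` (`ϑ = cutoff (4R) (a − ·)`), `√∫_{B̄(a,2R)} p₁² ≤ κ₁ · (C/√(−t)) · √∫ cutoff(8R)(a−·)|v(t)|²`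
  (ns-es-p1's C5 `…SparseEnergyPressureSplitNear.exists_sqrt_setIntegral_sq_pressurePotential_cutField_le`, Stein `p = 2`);
* `p₂ = Q₂^{R,2R}[ϑ•v(t)] − farPotentialMod R 2R a v(t)`, `osc_{B̄(a,2R)} p₂ ≤ κ₂ R Σ'_k ((2^kR)⁻¹)⁴ ∫ cutoff(2^{k+1}R)(a−·)|v(t)|²`
  (ns-es-p1's C3/C4 `…SparseEnergyPressureSplitFar.abs_farSplit_sub_le`; this seat's twin `…SparseEnergyFarOscillation`);
* `κ₁, κ₂` UNIVERSAL (independent of the profile, the window, the time, the ball).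

The identification `q(t) = pressurePotentialMod a (v t) + C(t)` is ns-es-p1's `PressureNormalisation.pressure_eq_pressurePotentialMod_add_const_of_oseenMild`
on the SUB-window `(T, t/2)` (where `|v| ≤ C/√(−t/2)` and, by the class rates `…ClassSpaceTimeRates`, `|∂ᵢ∂ⱼ(vᵢvⱼ)|` is bounded via
`TsaiLocalPressureSup.abs_pressureSource_le`), and the slice split is ns-es-p1's `exists_pressurePotentialMod_split` (C1 of K2-p2 g9 + C2).

`window_split` is EXACTLY the hypothesis `hwin` (with its `κ₁ κ₂ ≥ 0`) of `…SparseEnergyScaledEnergyOfSplit.scaledEnergy_of_split`; the sibling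
closing file `…SparseEnergyScaledEnergy` then proves S1 `stub_scaledEnergy` verbatim.

WHAT THIS IS NOT: not a claim about Navier–Stokes regularity or blow-up; an a-priori pressure representation for hypothetical Type-I
ancient profiles (bears_on LADDER-NS N0 via crux 19708, line sparse_energy, stub S1). [folklore]
-/

noncomputable section

-- the summit and its single sub-problem share the name (CONVENTIONS §1), as in every Theorems file
set_option linter.dupNamespace false

namespace Summit.NavierStokesRegularity.NavierStokesRegularity.Theorems.PoloidalWindowDoorPoloidalWindowRigiditySparseEnergyWindowSplit

-- nested operator types `ℝ³ →L[ℝ] ℝ³ →L[ℝ] ℝ³ →L[ℝ] ℝ`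
set_option maxSynthPendingDepth 3

open MeasureTheory Set Function Filter Topology Metric
open scoped ENNReal ContDiff
open Literature.Analysis Literature.Analysis.FluidPDE
open Summit.NavierStokesRegularity.NavierStokesRegularity.Theorems.PoloidalWindowDoorPoloidalWindowRigidityWindow
open Summit.NavierStokesRegularity.NavierStokesRegularity.Theorems.PoloidalWindowDoorPoloidalWindowRigidityClassSpaceTimeRates
open Summit.NavierStokesRegularity.NavierStokesRegularity.Theorems.PoloidalWindowDoorPoloidalWindowRigiditySparseEnergyPressureSplitNear
open Summit.NavierStokesRegularity.NavierStokesRegularity.Theorems.PoloidalWindowDoorPoloidalWindowRigiditySparseEnergyPressureSplitFar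

variable {C : ℝ} {v : ℝ → EuclideanSpace ℝ (Fin 3) → EuclideanSpace ℝ (Fin 3)}

/-- **The quadratic source of the class is bounded on every sub-window `(−∞, τ)`, `τ < 0`.**  For a profile of the Type-I class,
`|∂ᵢ∂ⱼ(vᵢvⱼ)(s, x)| ≤ N_G(τ)` for all `s < τ` and all `x`: `TsaiLocalPressureSup.abs_pressureSource_le` with the class rates
`|v(s)| ≤ C/√(−s)`, `‖Dv(s)‖ ≤ K₁/(−s)`, `‖D²v(s)‖ ≤ K₂/((−s)√(−s))` (`…ClassSpaceTimeRates`), all monotone in `−s ≥ −τ`. [folklore] -/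
theorem exists_abs_pressureSource_le_of_class (hrate : HasTypeITimeDecay C v)
    (hcont : ContinuousOn (uncurry v) (Iio (0 : ℝ) ×ˢ univ))
    (hmild : ∀ s t : ℝ, s < t → t < 0 → ∀ x,
      v t x = UnboundedOperators.heatExtension (v s) (t - s) x - oseenDuhamel 1 s v v t x)
    (hdiv : ∀ t < 0, VectorCalculus.IsDivFree (v t)) {τ : ℝ} (hτ : τ < 0) :
    ∃ NG : ℝ, ∀ s < τ, ∀ x, |pressureSource (v s) x| ≤ NG := by
  have hC0 : 0 ≤ C := by
    have h := hrate (-1) (by norm_num) 0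
    rw [neg_neg, Real.sqrt_one, div_one] at h
    exact (norm_nonneg _).trans h
  obtain ⟨K₁, hK₁0, hK₁⟩ := exists_fderiv_rate_of_class' hrate hcont hmild
  obtain ⟨K₂, hK₂0, hK₂⟩ := exists_iteratedFDeriv_two_rate_of_class' hrate hcont hmild
  have hmildA := isTypeIAncientMild_of_class hrate hcont hmild hdiv
  set Tn : ℝ := ‖(traceCLM : (EuclideanSpace ℝ (Fin 3) →L[ℝ] EuclideanSpace ℝ (Fin 3)) →L[ℝ] ℝ)‖ with hTn
  have hTn0 : 0 ≤ Tn := norm_nonneg _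
  have hnτ : 0 < -τ := neg_pos.2 hτ
  have hsτ : 0 < Real.sqrt (-τ) := Real.sqrt_pos.2 hnτ
  refine ⟨2 * Tn * (K₂ / ((-τ) * Real.sqrt (-τ))) * (C / Real.sqrt (-τ)) + (Tn + Tn ^ 2) * (K₁ / (-τ)) ^ 2,
    fun s hs x => ?_⟩
  have hs0 : s < 0 := hs.trans hτ
  have hns : 0 < -s := neg_pos.2 hs0
  have hss : 0 < Real.sqrt (-s) := Real.sqrt_pos.2 hns
  have hτs : -τ ≤ -s := by linarith
  have hsq : Real.sqrt (-τ) ≤ Real.sqrt (-s) := Real.sqrt_le_sqrt hτs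
  have hsm : IsSmoothSpaceTimeOn (Iio (0 : ℝ)) v := hmildA.contDiffOn
  have hv2 : ContDiff ℝ 2 (v s) := (hsm.contDiff_slice (mem_Iio.2 hs0)).of_le (by norm_cast)
  -- the three rates at time `s`, weakened to `τ`
  have h0 : ‖v s x‖ ≤ C / Real.sqrt (-τ) :=
    (hrate s hs0 x).trans (div_le_div_of_nonneg_left hC0 hsτ hsq)
  have h1 : ‖fderiv ℝ (v s) x‖ ≤ K₁ / (-τ) :=
    (hK₁ s hs0 x).trans (div_le_div_of_nonneg_left hK₁0 hnτ hτs)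
  have h2 : ‖fderiv ℝ (fderiv ℝ (v s)) x‖ ≤ K₂ / ((-τ) * Real.sqrt (-τ)) := by
    rw [← norm_iteratedFDeriv_one (𝕜 := ℝ) (fderiv ℝ (v s)), norm_iteratedFDeriv_fderiv]
    exact (hK₂ s hs0 x).trans (div_le_div_of_nonneg_left hK₂0 (mul_pos hnτ hsτ)
      (mul_le_mul hτs hsq hsτ.le hns.le))
  have hG := abs_pressureSource_le hv2 x
  calc |pressureSource (v s) x|
      ≤ 2 * Tn * ‖fderiv ℝ (fderiv ℝ (v s)) x‖ * ‖v s x‖ + (Tn + Tn ^ 2) * ‖fderiv ℝ (v s) x‖ ^ 2 := hG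
    _ ≤ 2 * Tn * (K₂ / ((-τ) * Real.sqrt (-τ))) * (C / Real.sqrt (-τ)) + (Tn + Tn ^ 2) * (K₁ / (-τ)) ^ 2 := by
        gcongr

/-- **C6 — THE WINDOW PRESSURE SPLIT OF THE TYPE-I CLASS** (= the hypothesis `hwin` of `…SparseEnergyScaledEnergyOfSplit.scaledEnergy_of_split`,
with universal constants `κ₁, κ₂ ≥ 0`).  For a profile `v` of the Type-I ancient mild class there are `κ₁, κ₂ ≥ 0` such that for every
`T < 0` the window `(T,0)` carries a classical pressure `q` with: for all `t ∈ (T,0)`, centres `a` and radii `R > 0` there are `c ∈ ℝ` and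
`p₁, p₂` with `p₁` continuous, `q(t) = c + p₁ + p₂` on `B̄(a,2R)`, `√∫_{B̄(a,2R)} p₁² ≤ κ₁ (C/√(−t)) √∫ cutoff(8R)(a−·)|v(t)|²`, and an
oscillation bound `O ≥ 0` of `p₂` over `B̄(a,2R)` with `O ≤ κ₂ R Σ'_k ((2^kR)⁻¹)⁴ ∫ cutoff(2^{k+1}R)(a−·)|v(t)|²`. [folklore] -/
theorem window_split (hrate : HasTypeITimeDecay C v)
    (hcont : ContinuousOn (uncurry v) (Iio (0 : ℝ) ×ˢ univ))
    (hmild : ∀ s t : ℝ, s < t → t < 0 → ∀ x,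
      v t x = UnboundedOperators.heatExtension (v s) (t - s) x - oseenDuhamel 1 s v v t x)
    (hdiv : ∀ t < 0, VectorCalculus.IsDivFree (v t)) :
    ∃ κ₁ κ₂ : ℝ, 0 ≤ κ₁ ∧ 0 ≤ κ₂ ∧ ∀ T : ℝ, T < 0 → ∃ q : ℝ → EuclideanSpace ℝ (Fin 3) → ℝ,
      IsClassicalNSSolutionOn (Ioo T 0) 1 0 v q ∧
      ∀ t ∈ Ioo T 0, ∀ (a : EuclideanSpace ℝ (Fin 3)) (R : ℝ), 0 < R →
        ∃ (c : ℝ) (p₁ p₂ : EuclideanSpace ℝ (Fin 3) → ℝ), Continuous p₁ ∧ (∀ x ∈ closedBall a (2 * R), q t x = c + p₁ x + p₂ x) ∧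
          Real.sqrt (∫ x in closedBall a (2 * R), p₁ x ^ 2) ≤
            κ₁ * (C / Real.sqrt (-t)) * Real.sqrt (∫ x, cutoff (8 * R) (a - x) * ‖v t x‖ ^ 2) ∧
          ∃ O : ℝ, 0 ≤ O ∧ (∀ x ∈ closedBall a (2 * R), ∀ y ∈ closedBall a (2 * R), |p₂ x - p₂ y| ≤ O) ∧
            O ≤ κ₂ * R * ∑' k : ℕ, ((2 : ℝ) ^ k * R)⁻¹ ^ 4 * ∫ x, cutoff ((2 : ℝ) ^ (k + 1) * R) (a - x) * ‖v t x‖ ^ 2 := by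
  obtain ⟨κ₁, hκ₁0, hκ₁⟩ := exists_sqrt_setIntegral_sq_pressurePotential_cutField_le
  obtain ⟨M, hM0, hM⟩ := PoloidalWindowDoorPoloidalWindowRigiditySparseEnergyPressureSplitFar.exists_norm_fderiv3_newtonKernel_le
  refine ⟨κ₁, 64 * M, hκ₁0, by positivity, fun T hT => ?_⟩
  have hC0 : 0 ≤ C := by
    have h := hrate (-1) (by norm_num) 0
    rw [neg_neg, Real.sqrt_one, div_one] at h
    exact (norm_nonneg _).trans h
  have hmildA := isTypeIAncientMild_of_class hrate hcont hmild hdiv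
  obtain ⟨q, hcl⟩ := hmildA.exists_isClassicalNSSolutionOn_Ioo hT
  refine ⟨q, hcl, fun t ht a R hR => ?_⟩
  have ht0 : t < 0 := ht.2
  have hnt : 0 < -t := neg_pos.2 ht0
  -- (1) the identification on the sub-window `(T, t/2)`
  set τ : ℝ := t / 2 with hτ
  have hτ0 : τ < 0 := by rw [hτ]; linarith
  have htτ : t < τ := by rw [hτ]; linarith
  have hnτ : 0 < -τ := neg_pos.2 hτ0
  have hsτ : 0 < Real.sqrt (-τ) := Real.sqrt_pos.2 hnτ
  have hsub : Ioo T τ ⊆ Ioo T 0 := Ioo_subset_Ioo_right hτ0.le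
  have hcl' : IsClassicalNSSolutionOn (Ioo T τ) 1 0 v q := hcl.mono hsub (uniqueDiffOn_Ioo T τ)
  have htI : t ∈ Ioo T τ := ⟨ht.1, htτ⟩
  have hN : ∀ s ∈ Ioo T τ, ∀ x, ‖v s x‖ ≤ C / Real.sqrt (-τ) := by
    intro s hs x
    have hs0 : s < 0 := hs.2.trans hτ0
    exact (hrate s hs0 x).trans (div_le_div_of_nonneg_left hC0 hsτ (Real.sqrt_le_sqrt (by linarith [hs.2])))
  obtain ⟨NG, hNG⟩ := exists_abs_pressureSource_le_of_class hrate hcont hmild hdiv hτ0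
  have hG : ∀ s ∈ Ioo T τ, ∀ x, |pressureSource (v s) x| ≤ NG := fun s hs x => hNG s hs.2 x
  have hmild' : ∀ s ∈ Ioo T τ, ∀ s' ∈ Ioo T τ, s < s' → ∀ x,
      v s' x = UnboundedOperators.heatExtension (v s) (s' - s) x - oseenDuhamel 1 s v v s' x :=
    fun s _ s' hs' hss' x => hmild s s' hss' (hs'.2.trans hτ0) x
  obtain ⟨Cq, hCq⟩ :=
    PressureNormalisation.pressure_eq_pressurePotentialMod_add_const_of_oseenMild hcl' hN hG hmild' a htI
  -- (2) the slice `u = v t`: smooth, `|u| ≤ C/√(−t)`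
  have hu : ContDiff ℝ ∞ (v t) := hcl.contDiff_velocity ht
  have hNt : ∀ z, ‖v t z‖ ≤ C / Real.sqrt (-t) := fun z => hrate t ht0 z
  obtain ⟨c, hc⟩ := exists_pressurePotentialMod_split hR hu hNt a a
  obtain ⟨hws, hwc, hwle, -⟩ := cutField_smooth hu a hR
  set w : EuclideanSpace ℝ (Fin 3) → EuclideanSpace ℝ (Fin 3) := fun z => cutoff (4 * R) (a - z) • v t z with hw
  have hw2c : HasCompactSupport fun y => ‖w y‖ ^ 2 := hwc.norm.comp_left (g := fun r : ℝ => r ^ 2) (zero_pow two_ne_zero)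
  have hL2w : Integrable fun y => ‖w y‖ ^ 2 := (hws.continuous.norm.pow 2).integrable_of_hasCompactSupport hw2c
  have hp₁c : Continuous (pressurePotential w) := (contDiff_pressurePotential (contDiff_infty.1 hws 4) hL2w).continuous
  have hR1 : 0 < R * 1 := by linarith
  have hR12 : R * 1 < R * 2 := by linarith
  have hR2 : R * 2 ≤ 2 * R := by linarith
  refine ⟨Cq + c, pressurePotential w, fun x => farPotential (R * 1) (R * 2) w x - farPotentialMod (R * 1) (R * 2) a (v t) x,
    hp₁c, fun x hx => ?_, (hκ₁ (v t) (C / Real.sqrt (-t)) hu hNt a R hR).2, ?_⟩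
  · rw [hCq x, hc x hx]
    ring
  · refine ⟨64 * M * R * ∑' k : ℕ, ((2 : ℝ) ^ k * R)⁻¹ ^ 4 * ∫ x, cutoff ((2 : ℝ) ^ (k + 1) * R) (a - x) * ‖v t x‖ ^ 2,
      ?_, fun x hx y hy => abs_farSplit_sub_le hR1 hR12 hR hR2 hu.continuous hNt a a hM0 hM hx hy, le_of_eq (by ring)⟩
    refine mul_nonneg (by positivity) (tsum_nonneg fun k => mul_nonneg (pow_nonneg (inv_nonneg.2 (by positivity)) 4)
      (integral_nonneg fun x => mul_nonneg (cutoff_nonneg _ _) (sq_nonneg _)))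

end Summit.NavierStokesRegularity.NavierStokesRegularity.Theorems.PoloidalWindowDoorPoloidalWindowRigiditySparseEnergyWindowSplit

end
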